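import Summits.BirchSwinnertonDyer.BirchSwinnertonDyer.Theorems.TwoAdicConverseFullTwoTorsionNeitherSemistable
import Summits.BirchSwinnertonDyer.BirchSwinnertonDyer.Theorems.TwoAdicConverseOffHabitatStrataLeaf
import Summits.BirchSwinnertonDyer.Rank1Residual.X2.IsogenyQuotientLine
import HarnessLib

/-!
# Route `TwoAdicConverse` (rung S3), items 19218 / 19219 and the leaf: the `ℤ/2`-linked PAIR calculus on the
# whole semistable-at-`2` domain `GoodOrd W 2 ∨ Mult W 2` — GEN 19's displayed binder `hW'` discharged, the
# (β) piece of the `r ≤ 1` LEAF (and of 19219) shrinks to the two Greenberg configurations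

Cell `bsd-2adic` (run/shared/lean/pub/bsd-2adic/), seat `bsd-2adic-conv-1` (GEN 20).  THEOREMS ONLY — no
definition, no named fact, no `sorry`; `--supports stmt-BirchSwinnertonDyer-19218`.  HONEST FRAMING: BSD is not
proved by any of this; item 19218 and its research inputs stay OPEN; nothing is booked.  PARTITION (D-0054): none —
RANK axis (S3), stratum (β) «`E(ℚ)[2] ≠ 0`» of the off-habitat complement at a good-ordinary OR multiplicative `2`.

conv-1 GEN 19 (`TwoAdicConverseTwoTorsionIsogenyPairs`, `…FullTwoTorsionNeitherSemistable`) organised stratum (β)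
by `ℤ/2`-linked pairs `(W, W')` (`C • W` in two-torsion normal form, `C' • W' = (C • W).twoIsogenyCodomain`) and
eliminated the «neither ramified nor odd» configuration at a GOOD ORDINARY `2`; at a multiplicative `2` the one
missing transport — «a curve `ℚ`-isogenous to a multiplicative-at-`2` curve is multiplicative at `2`» — was
DISPLAYED as the hypothesis `hW'`.  That transport is a tree theorem (Silverman *AEC* VII.7.2 + §C.16 via equal
local `L`-factors: `WeierstrassCurve.Isogeny.hasMultiplicativeReductionAt_of_hasMultiplicativeReductionAt`, prime
form `Rank1Residual.X2.IsogenyQuotientLine.hasMultiplicativeReductionAtPrime_of_isIsogenous`), so here: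

* §1 `mult_two_iff_of_twoTorsionPair`, `goodOrd_or_mult_two_iff_of_twoTorsionPair`,
  `goodOrd_or_mult_two_of_isIsogenous` (= GEN 19's `hW'`, proved).
* §2 `exists_partner_ramified_and_odd_of_fullTwoTorsion_of_goodOrd_or_mult'` — GEN 19's §3 theorem with `hW'`
  DISCHARGED; `exists_partner_one_le_mu_of_fullTwoTorsion_of_goodOrd_or_mult` — every full-`2`-torsion class that is
  good-ordinary OR multiplicative at `2` has a member with `μ ≥ 1` (Greenberg Prop. 5.13 BY NAME, binder `h513`,
  which is printed for both reduction types).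
* §3 **the (β) piece of the `r ≤ 1` LEAF on `GoodOrd W 2 ∨ Mult W 2` ⇐ (M) mixed ∧ (R) ramified-odd**
  (`semistable_twoTorsion_leaf_of_mixed_of_ramifiedOdd`; the conclusion is VERBATIM the `h2t` binder of
  `leaf_offBigImage_of_strata`, and of `offHabitatNonSurjTwoConverse_of_strata` for KRR2's residual 24303 — that
  corollary is left to the importer so that this file stays outside KolyvaginRankRigidityAtTwo's theses cone), hence
  the rung leaf BY NAME with (β) split into (M)/(R) (`nonCMTwoConverse_of_kolyvaginAtTwo_of_pairs_of_strata`).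
* §4 the `r = 0` multiplicative twin: item 19219's (β) piece ⇐ (M) ∧ (R) (`mult_twoTorsion_rankZero_of_mixed_of_ramifiedOdd`),
  its off-habitat binder by strata (`mult_offBigImage_rankZero_of_pairs_of_strata`) and 19219 BY NAME
  (`multiplicativeRankZeroTwoConverse_of_kolyvaginAtTwo_of_pairs_of_strata`).

References: R. Greenberg, LNM 1716 (1999), §5 Props. 5.13–5.14 [GreenbergLNM1716]; J. H. Silverman, *AEC*,
III.4.5, VII.7.2, §C.16, VIII.8.3 [SilvermanAEC2009]; T. & V. Dokchitser, Math. Z. 272 (2012) 961–964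
[DokchitserDokchitserMathZ2012]; W. Zhang, Camb. J. Math. 2 (2014) Thm. 1.1 (shape) [WZhang2014].
-/

set_option linter.dupNamespace false  -- `BirchSwinnertonDyer.BirchSwinnertonDyer` is the sub's path (D-0017)
set_option autoImplicit false

noncomputable section

open scoped Classical
open WeierstrassCurve Literature Literature.NumberTheory.EllipticCurves
  Literature.NumberTheory.EllipticCurves.Rank1Residual
  Literature.NumberTheory.EllipticCurves.Greenberg1999
  Summit.BirchSwinnertonDyer.BirchSwinnertonDyer.Theses.TwoAdicConverse
  Summit.BirchSwinnertonDyer.BirchSwinnertonDyer.Theorems.TwoAdicKolyvaginRankZero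

namespace Summit.BirchSwinnertonDyer.BirchSwinnertonDyer.Theorems.TwoAdicOffHabitat

/-! ## §1 Multiplicative reduction at `2` passes along a `ℤ/2`-linked pair -/

section Pair

variable {W W' : WeierstrassCurve ℚ} [W.IsElliptic] [W'.IsElliptic] {C C' : VariableChange ℚ}

/-- **Multiplicative reduction at `2` passes along the pair** (isogenous curves have the same type of bad
reduction: *AEC* VII.7.2 for the good places and §C.16 / equal local `L`-factors for multiplicative vs additive;
tree theorem `X2.IsogenyQuotientLine.hasMultiplicativeReductionAtPrime_of_isIsogenous`).
[cite: SilvermanAEC2009, Cor. VII.7.2 and §C.16] -/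
theorem mult_two_iff_of_twoTorsionPair [(C • W).IsTwoTorsionNF]
    (hlink : C' • W' = (C • W).twoIsogenyCodomain) : Mult W 2 ↔ Mult W' 2 := by
  haveI : Fact (Nat.Prime 2) := ⟨Nat.prime_two⟩
  have h := isIsogenous_of_twoTorsionPair hlink
  exact ⟨Summit.BirchSwinnertonDyer.Rank1Residual.X2.IsogenyQuotientLine.hasMultiplicativeReductionAtPrime_of_isIsogenous h,
    Summit.BirchSwinnertonDyer.Rank1Residual.X2.IsogenyQuotientLine.hasMultiplicativeReductionAtPrime_of_isIsogenous
      h.symm_of_charZero⟩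

/-- **Good-ordinary-or-multiplicative at `2` (the leaf's domain) passes along the pair.**
[cite: SilvermanAEC2009, Cor. VII.7.2 and §C.16] -/
theorem goodOrd_or_mult_two_iff_of_twoTorsionPair [W.IsGloballyMinimal] [W'.IsGloballyMinimal]
    [(C • W).IsTwoTorsionNF] (hlink : C' • W' = (C • W).twoIsogenyCodomain) :
    (GoodOrd W 2 ∨ Mult W 2) ↔ (GoodOrd W' 2 ∨ Mult W' 2) :=
  or_congr (goodOrd_two_iff_of_twoTorsionPair hlink) (mult_two_iff_of_twoTorsionPair hlink)

end Pair

variable (W : WeierstrassCurve ℚ) [W.IsElliptic] [W.IsGloballyMinimal]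

/-- **GEN 19's displayed binder `hW'`, proved**: every globally minimal curve `ℚ`-isogenous to a curve that is
good-ordinary or multiplicative at `2` is again good-ordinary or multiplicative at `2` (good reduction and `a₂` along
an isogeny: *AEC* VII.7.2, Faltings; multiplicative reduction: equal local factors, §C.16).
[cite: SilvermanAEC2009, Cor. VII.7.2 and §C.16] -/
theorem goodOrd_or_mult_two_of_isIsogenous (hW : GoodOrd W 2 ∨ Mult W 2) :
    ∀ (W' : WeierstrassCurve ℚ) [W'.IsElliptic] [W'.IsGloballyMinimal], IsIsogenous W W' →
      GoodOrd W' 2 ∨ Mult W' 2 := by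
  haveI : Fact (Nat.Prime 2) := ⟨Nat.prime_two⟩
  intro W' _ _ h
  rcases hW with hgo | hm
  · exact Or.inl ⟨(h.hasGoodReductionAtPrime_iff 2).mp hgo.1, (h.not_dvd_frobeniusTrace_iff 2 hgo.1).mp hgo.2⟩
  · exact Or.inr
      (Summit.BirchSwinnertonDyer.Rank1Residual.X2.IsogenyQuotientLine.hasMultiplicativeReductionAtPrime_of_isIsogenous
        h hm)

/-! ## §2 Full rational `2`-torsion at a good-ordinary or multiplicative `2`: the 5.13 partner, unconditionally -/

/-- **Good ordinary or multiplicative at `2`, full rational `2`-torsion ⟹ a `ℤ/2`-partner whose dual-kernel point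
is ramified AND odd** — GEN 19's `exists_partner_ramified_and_odd_of_fullTwoTorsion_of_goodOrd_or_mult` with its
displayed transport hypothesis `hW'` DISCHARGED by `goodOrd_or_mult_two_of_isIsogenous`.
[cite: GreenbergLNM1716, §5 Props. 5.13–5.14 (pp. 120–121)] [cite: SilvermanAEC2009, Cor. VII.7.2 and §C.16] -/
theorem exists_partner_ramified_and_odd_of_fullTwoTorsion_of_goodOrd_or_mult' (hW : GoodOrd W 2 ∨ Mult W 2)
    {x₁ x₂ x₃ : ℚ} (h12 : x₁ ≠ x₂) (h13 : x₁ ≠ x₃) (h23 : x₂ ≠ x₃) (h₁ : HasRationalTwoTorsionX W x₁)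
    (h₂ : HasRationalTwoTorsionX W x₂) (h₃ : HasRationalTwoTorsionX W x₃) :
    ∃ (C : VariableChange ℚ) (_ : (C • W).IsTwoTorsionNF) (W' : WeierstrassCurve ℚ) (_ : W'.IsElliptic)
      (_ : W'.IsGloballyMinimal) (C' : VariableChange ℚ),
      C' • W' = (C • W).twoIsogenyCodomain ∧ (GoodOrd W' 2 ∨ Mult W' 2) ∧ (W.HasCM ↔ W'.HasCM) ∧
      HasRationalTwoTorsionX W' C'.r ∧ TwoTorsionRamifiedAtTwo C'.r ∧ TwoTorsionOdd W' C'.r :=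
  exists_partner_ramified_and_odd_of_fullTwoTorsion_of_goodOrd_or_mult W hW
    (goodOrd_or_mult_two_of_isIsogenous W hW) h12 h13 h23 h₁ h₂ h₃

/-- **Every full-`2`-torsion `ℚ`-isogeny class that is good-ordinary OR multiplicative at `2` has a member with
`μ ≥ 1`** (Greenberg Prop. 5.13 BY NAME — binder `h513`, printed for «good ordinary or multiplicative reduction at
`2`» — applied at the partner of §2; conv-1 GEN 19's `exists_partner_one_le_mu_of_fullTwoTorsion` is the
good-ordinary case; census: 19/19 good-ordinary and 24/24 multiplicative full-`2`-torsion classes show such a member).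
[cite: GreenbergLNM1716, §5 Prop. 5.13 (p. 120) and the conductor-15 example (pp. 123–124)] -/
theorem exists_partner_one_le_mu_of_fullTwoTorsion_of_goodOrd_or_mult
    (h513 : prop513_one_le_mu_two_of_ramified_odd) (hW : GoodOrd W 2 ∨ Mult W 2) {x₁ x₂ x₃ : ℚ}
    (h12 : x₁ ≠ x₂) (h13 : x₁ ≠ x₃) (h23 : x₂ ≠ x₃) (h₁ : HasRationalTwoTorsionX W x₁)
    (h₂ : HasRationalTwoTorsionX W x₂) (h₃ : HasRationalTwoTorsionX W x₃) :
    ∃ (W' : WeierstrassCurve ℚ) (_ : W'.IsElliptic) (_ : W'.IsGloballyMinimal),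
      IsIsogenous W W' ∧ (GoodOrd W' 2 ∨ Mult W' 2) ∧ (W.HasCM ↔ W'.HasCM) ∧
      ∀ (κ : ZpExtension ℚ 2) (γ : Field.absoluteGaloisGroup ℚ), κ.IsCyclotomic → κ.IsTopGenerator γ →
        ∀ D : W'.SelmerDualData κ γ, D.IsTorsion → 1 ≤ D.mu := by
  haveI : Fact (Nat.Prime 2) := ⟨Nat.prime_two⟩
  obtain ⟨C, hNF, W', hE', hmin', C', hlink, hW', hCM, hx', hR', hO'⟩ :=
    exists_partner_ramified_and_odd_of_fullTwoTorsion_of_goodOrd_or_mult' W hW h12 h13 h23 h₁ h₂ h₃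
  obtain ⟨y', hEq', h2'⟩ := hx'
  have hred' : (W'.HasGoodReductionAtPrime 2 ∧ ¬ (2 : ℤ) ∣ W'.frobeniusTrace 2) ∨
      W'.HasMultiplicativeReductionAtPrime 2 := by
    rcases hW' with hgo' | hm'
    · exact Or.inl ⟨hgo'.1, hgo'.2⟩
    · exact Or.inr hm'
  exact ⟨W', hE', hmin', isIsogenous_of_twoTorsionPair hlink, hW', hCM, fun κ γ hκ hγ D hX ↦
    h513 W' hred' C'.r y' hEq' h2' hR' hO' κ γ hκ hγ D hX⟩

/-! ## §3 The (β) piece of the `r ≤ 1` LEAF on `GoodOrd W 2 ∨ Mult W 2` from the two configurations -/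

/-- **The `r ≤ 1` leaf shape on stratum (β), good-ordinary OR multiplicative at `2`, from (M) and (R).**  If
`corank_{ℤ₂} Sel_{2^∞} = r ⟹ r_an = r` (`r ≤ 1`) holds for every non-CM minimal `W`, good-ordinary or
multiplicative at `2`, carrying a Prop-5.14 point (M: ramified XOR odd) and for every one carrying a Prop-5.13
point (R: ramified AND odd), then it holds for every such `W` with a rational point of order `2`: a «neither» point
is traded for the dual-kernel point `P'` on the minimal partner `W'`, which is ramified and odd
(`neither_iff_ramified_and_odd_of_twoIsogeny`, `a₁` odd on both minimal equations), and reduction type, CM, corank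
and analytic rank are isogeny invariants (§1).  The conclusion is VERBATIM the binder `h2t` of
`leaf_offBigImage_of_strata`. [cite: GreenbergLNM1716, Props. 5.13–5.14 (chunks p0168–p0170)]
[cite: SilvermanAEC2009, III.4 Example 4.5, Cor. VII.7.2, §C.16 and VIII.8.3] -/
theorem semistable_twoTorsion_leaf_of_mixed_of_ramifiedOdd
    (hM : ∀ (W : WeierstrassCurve ℚ) [W.IsElliptic] [W.IsGloballyMinimal], ¬ W.HasCM →
      (GoodOrd W 2 ∨ Mult W 2) →
      (∃ x : ℚ, HasRationalTwoTorsionX W x ∧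
        ((TwoTorsionRamifiedAtTwo x ∧ ¬ TwoTorsionOdd W x) ∨ (TwoTorsionOdd W x ∧ ¬ TwoTorsionRamifiedAtTwo x))) →
      ∀ r : ℕ, r ≤ 1 → W.selmerCorank 2 = r → W.analyticRank = r)
    (hR : ∀ (W : WeierstrassCurve ℚ) [W.IsElliptic] [W.IsGloballyMinimal], ¬ W.HasCM →
      (GoodOrd W 2 ∨ Mult W 2) →
      (∃ x : ℚ, HasRationalTwoTorsionX W x ∧ TwoTorsionRamifiedAtTwo x ∧ TwoTorsionOdd W x) →
      ∀ r : ℕ, r ≤ 1 → W.selmerCorank 2 = r → W.analyticRank = r) :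
    ∀ (W : WeierstrassCurve ℚ) [W.IsElliptic] [W.IsGloballyMinimal], ¬ W.HasCM →
      (GoodOrd W 2 ∨ Mult W 2) → (∃ P : W.toAffine.Point, P ≠ 0 ∧ 2 • P = 0) →
      ∀ r : ℕ, r ≤ 1 → W.selmerCorank 2 = r → W.analyticRank = r := by
  intro W _ _ hCM hred hP r hr hc
  obtain ⟨x₀, y₀, hEq, h2⟩ := (exists_two_torsion_iff_exists_hasRationalTwoTorsionX W).mp hP
  by_cases hmix : (TwoTorsionRamifiedAtTwo x₀ ∧ ¬ TwoTorsionOdd W x₀) ∨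
      (TwoTorsionOdd W x₀ ∧ ¬ TwoTorsionRamifiedAtTwo x₀)
  · exact hM W hCM hred ⟨x₀, ⟨y₀, hEq, h2⟩, hmix⟩ r hr hc
  by_cases hRO : TwoTorsionRamifiedAtTwo x₀ ∧ TwoTorsionOdd W x₀
  · exact hR W hCM hred ⟨x₀, ⟨y₀, hEq, h2⟩, hRO⟩ r hr hc
  -- «neither»: pass to the partner
  have hN : ¬ TwoTorsionRamifiedAtTwo x₀ ∧ ¬ TwoTorsionOdd W x₀ := by tauto
  set C : VariableChange ℚ := ⟨1, x₀, -W.a₁ / 2, y₀⟩ with hC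
  have hns : W.toAffine.Nonsingular x₀ y₀ := (WeierstrassCurve.Affine.equation_iff_nonsingular).mp hEq
  have hy₀ : y₀ = W.toAffine.negY x₀ y₀ := by
    rw [WeierstrassCurve.Affine.negY]; linear_combination h2
  haveI hNF : (C • W).IsTwoTorsionNF := isTwoTorsionNF_smul_of_two_nsmul_eq_zero two_ne_zero hns hy₀
  obtain ⟨C₀, hmin⟩ := hasGlobalMinimalModel_rat_holds (C • W).twoIsogenyCodomain
  set W' : WeierstrassCurve ℚ := C₀ • (C • W).twoIsogenyCodomain with hW'
  haveI : W'.IsGloballyMinimal := hmin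
  have hlink : C₀⁻¹ • W' = (C • W).twoIsogenyCodomain := inv_smul_smul C₀ _
  haveI : (C₀⁻¹ • W').IsTwoTorsionNF := by rw [hlink]; infer_instance
  have hCr : C.r = x₀ := rfl
  -- transport the data
  have hred' : GoodOrd W' 2 ∨ Mult W' 2 := (goodOrd_or_mult_two_iff_of_twoTorsionPair hlink).mp hred
  have hCM' : ¬ W'.HasCM := fun h ↦ hCM ((hasCM_iff_of_twoTorsionPair hlink).mpr h)
  have ha₁ := odd_a₁_integralModelInt_of_goodOrd_or_mult W hred
  have ha₁' := odd_a₁_integralModelInt_of_goodOrd_or_mult W' hred'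
  have hRO' : TwoTorsionRamifiedAtTwo C₀⁻¹.r ∧ TwoTorsionOdd W' C₀⁻¹.r :=
    (neither_iff_ramified_and_odd_of_twoIsogeny W W' C C₀⁻¹ ha₁ ha₁' hlink).mp (hCr ▸ hN)
  have hx' : HasRationalTwoTorsionX W' C₀⁻¹.r := hasRationalTwoTorsionX_of_isTwoTorsionNF_smul W' C₀⁻¹
  have h' := hR W' hCM' hred' ⟨C₀⁻¹.r, hx', hRO'⟩ r hr
  exact (twoConverseAt_iff_of_twoTorsionPair hlink r).mpr h' hc

/-- **The rung leaf `NonCMTwoConverse` from Kolyvagin at `2` on the habitat (S3 items 24622 V1′ + 24623 V2♭ +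
24405 + 23951 + BFH + GZK, conv-1 GEN 17 p607060) and the off-habitat strata with (β) split into (M)/(R) along
`ℤ/2`-linked pairs on the whole semistable-at-`2` domain.**  Every binder is a research statement or a printed fact
displayed by name; BSD is not proved by this. [cite: WZhang2014, Thm. 1.1 (shape at p ≥ 5)]
[cite: GreenbergLNM1716, Props. 5.13–5.14 (chunks p0168–p0170)] [cite: DokchitserDokchitserMathZ2012, Theorem (1)–(3)] -/
theorem nonCMTwoConverse_of_kolyvaginAtTwo_of_pairs_of_strata
    (hV1 : KolyvaginNonvanishingAtTwoFrame) (hV2 : KolyvaginCorankLowerBoundAtTwo)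
    (hT : Summit.BirchSwinnertonDyer.BirchSwinnertonDyer.Theses.TwoAdicConverse.NoTwoTorsionOverK)
    (hIn : Summit.BirchSwinnertonDyer.BirchSwinnertonDyer.Theses.TwoAdicConverse.PrintedInputsRankOneAtTwo)
    (hBFH : bumpFriedbergHoffstein_exists_heegnerField_split_twist_simpleZero)
    (hGZK : rank_eq_analyticRank_of_analyticRank_le_one)
    (hM : ∀ (W : WeierstrassCurve ℚ) [W.IsElliptic] [W.IsGloballyMinimal], ¬ W.HasCM →
      (GoodOrd W 2 ∨ Mult W 2) →
      (∃ x : ℚ, HasRationalTwoTorsionX W x ∧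
        ((TwoTorsionRamifiedAtTwo x ∧ ¬ TwoTorsionOdd W x) ∨ (TwoTorsionOdd W x ∧ ¬ TwoTorsionRamifiedAtTwo x))) →
      ∀ r : ℕ, r ≤ 1 → W.selmerCorank 2 = r → W.analyticRank = r)
    (hR : ∀ (W : WeierstrassCurve ℚ) [W.IsElliptic] [W.IsGloballyMinimal], ¬ W.HasCM →
      (GoodOrd W 2 ∨ Mult W 2) →
      (∃ x : ℚ, HasRationalTwoTorsionX W x ∧ TwoTorsionRamifiedAtTwo x ∧ TwoTorsionOdd W x) →
      ∀ r : ℕ, r ≤ 1 → W.selmerCorank 2 = r → W.analyticRank = r)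
    (h2c : ∀ (W : WeierstrassCurve ℚ) [W.IsElliptic] [W.IsGloballyMinimal], ¬ W.HasCM →
      (GoodOrd W 2 ∨ Mult W 2) → (∀ P : W.toAffine.Point, 2 • P = 0 → P = 0) →
      ¬ W.HasSurjectiveModNGaloisRep 2 → ∀ r : ℕ, r ≤ 1 → W.selmerCorank 2 = r → W.analyticRank = r)
    (h4 : ∀ (W : WeierstrassCurve ℚ) [W.IsElliptic] [W.IsGloballyMinimal], ¬ W.HasCM →
      (GoodOrd W 2 ∨ Mult W 2) → W.HasSurjectiveModNGaloisRep 2 → ¬ W.HasSurjectiveModNGaloisRep 4 →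
      ∀ r : ℕ, r ≤ 1 → W.selmerCorank 2 = r → W.analyticRank = r)
    (h8 : ∀ (W : WeierstrassCurve ℚ) [W.IsElliptic] [W.IsGloballyMinimal], ¬ W.HasCM →
      (GoodOrd W 2 ∨ Mult W 2) → W.HasSurjectiveModNGaloisRep 4 → ¬ W.HasSurjectiveModNGaloisRep 8 →
      ∀ r : ℕ, r ≤ 1 → W.selmerCorank 2 = r → W.analyticRank = r) :
    Summit.BirchSwinnertonDyer.BirchSwinnertonDyer.Rank1Residual.NonCMTwoConverse :=
  nonCMTwoConverse_of_kolyvaginAtTwo_of_strata hV1 hV2 hT hIn hBFH hGZK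
    (semistable_twoTorsion_leaf_of_mixed_of_ramifiedOdd hM hR) h2c h4 h8

/-! ## §4 The `r = 0` multiplicative twin (item 19219's (β) piece) -/

/-- **Item 19219's (β) piece from the two configurations**: if the rank-`0` `2`-converse holds for every non-CM
multiplicative-at-`2` minimal `W` carrying a Prop-5.14 point (M) and for every one carrying a Prop-5.13 point (R),
it holds for every non-CM multiplicative-at-`2` minimal `W` with a rational point of order `2` (a «neither» point
is traded for the partner's 5.13 point; the partner is again multiplicative at `2`, §1).
[cite: GreenbergLNM1716, Props. 5.13–5.14 (chunks p0168–p0170)] [cite: SilvermanAEC2009, Cor. VII.7.2 and §C.16] -/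
theorem mult_twoTorsion_rankZero_of_mixed_of_ramifiedOdd
    (hM : ∀ (W : WeierstrassCurve ℚ) [W.IsElliptic] [W.IsGloballyMinimal], ¬ W.HasCM → Mult W 2 →
      (∃ x : ℚ, HasRationalTwoTorsionX W x ∧
        ((TwoTorsionRamifiedAtTwo x ∧ ¬ TwoTorsionOdd W x) ∨ (TwoTorsionOdd W x ∧ ¬ TwoTorsionRamifiedAtTwo x))) →
      W.selmerCorank 2 = 0 → W.analyticRank = 0)
    (hR : ∀ (W : WeierstrassCurve ℚ) [W.IsElliptic] [W.IsGloballyMinimal], ¬ W.HasCM → Mult W 2 →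
      (∃ x : ℚ, HasRationalTwoTorsionX W x ∧ TwoTorsionRamifiedAtTwo x ∧ TwoTorsionOdd W x) →
      W.selmerCorank 2 = 0 → W.analyticRank = 0) :
    ∀ (W : WeierstrassCurve ℚ) [W.IsElliptic] [W.IsGloballyMinimal], ¬ W.HasCM → Mult W 2 →
      (∃ P : W.toAffine.Point, P ≠ 0 ∧ 2 • P = 0) → W.selmerCorank 2 = 0 → W.analyticRank = 0 := by
  intro W _ _ hCM hm hP hc
  obtain ⟨x₀, y₀, hEq, h2⟩ := (exists_two_torsion_iff_exists_hasRationalTwoTorsionX W).mp hP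
  by_cases hmix : (TwoTorsionRamifiedAtTwo x₀ ∧ ¬ TwoTorsionOdd W x₀) ∨
      (TwoTorsionOdd W x₀ ∧ ¬ TwoTorsionRamifiedAtTwo x₀)
  · exact hM W hCM hm ⟨x₀, ⟨y₀, hEq, h2⟩, hmix⟩ hc
  by_cases hRO : TwoTorsionRamifiedAtTwo x₀ ∧ TwoTorsionOdd W x₀
  · exact hR W hCM hm ⟨x₀, ⟨y₀, hEq, h2⟩, hRO⟩ hc
  have hN : ¬ TwoTorsionRamifiedAtTwo x₀ ∧ ¬ TwoTorsionOdd W x₀ := by tauto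
  set C : VariableChange ℚ := ⟨1, x₀, -W.a₁ / 2, y₀⟩ with hC
  have hns : W.toAffine.Nonsingular x₀ y₀ := (WeierstrassCurve.Affine.equation_iff_nonsingular).mp hEq
  have hy₀ : y₀ = W.toAffine.negY x₀ y₀ := by
    rw [WeierstrassCurve.Affine.negY]; linear_combination h2
  haveI hNF : (C • W).IsTwoTorsionNF := isTwoTorsionNF_smul_of_two_nsmul_eq_zero two_ne_zero hns hy₀
  obtain ⟨C₀, hmin⟩ := hasGlobalMinimalModel_rat_holds (C • W).twoIsogenyCodomain
  set W' : WeierstrassCurve ℚ := C₀ • (C • W).twoIsogenyCodomain with hW'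
  haveI : W'.IsGloballyMinimal := hmin
  have hlink : C₀⁻¹ • W' = (C • W).twoIsogenyCodomain := inv_smul_smul C₀ _
  haveI : (C₀⁻¹ • W').IsTwoTorsionNF := by rw [hlink]; infer_instance
  have hCr : C.r = x₀ := rfl
  have hm' : Mult W' 2 := (mult_two_iff_of_twoTorsionPair hlink).mp hm
  have hCM' : ¬ W'.HasCM := fun h ↦ hCM ((hasCM_iff_of_twoTorsionPair hlink).mpr h)
  have ha₁ := odd_a₁_integralModelInt_of_goodOrd_or_mult W (Or.inr hm)
  have ha₁' := odd_a₁_integralModelInt_of_goodOrd_or_mult W' (Or.inr hm')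
  have hRO' : TwoTorsionRamifiedAtTwo C₀⁻¹.r ∧ TwoTorsionOdd W' C₀⁻¹.r :=
    (neither_iff_ramified_and_odd_of_twoIsogeny W W' C C₀⁻¹ ha₁ ha₁' hlink).mp (hCr ▸ hN)
  have hx' : HasRationalTwoTorsionX W' C₀⁻¹.r := hasRationalTwoTorsionX_of_isTwoTorsionNF_smul W' C₀⁻¹
  have h' := hR W' hCM' hm' ⟨C₀⁻¹.r, hx', hRO'⟩
  exact (rankZeroTwoConverseAt_iff_of_twoTorsionPair hlink).mpr h' hc

/-- **Item 19219's `r = 0` off-habitat binder from LEVEL strata with (β) split along `ℤ/2`-linked pairs**: (M) mixed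
and (R) ramified-odd rational `2`-torsion, (S2c) `C₃` image, (S4) onto mod `2` not mod `4`, (S8) onto mod `4` not mod
`8` — each at a multiplicative `2`, `r = 0`.  The conclusion is VERBATIM the `hOff` binder of
`multiplicativeRankZeroTwoConverse_of_kolyvaginAtTwo_of_offBigImage` (conv-1 GEN 17 p607060).
[cite: DokchitserDokchitserMathZ2012, Theorem (1)–(3)] [cite: GreenbergLNM1716, Props. 5.13–5.14 (chunks p0168–p0170)] -/
theorem mult_offBigImage_rankZero_of_pairs_of_strata
    (hM : ∀ (W : WeierstrassCurve ℚ) [W.IsElliptic] [W.IsGloballyMinimal], ¬ W.HasCM → Mult W 2 →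
      (∃ x : ℚ, HasRationalTwoTorsionX W x ∧
        ((TwoTorsionRamifiedAtTwo x ∧ ¬ TwoTorsionOdd W x) ∨ (TwoTorsionOdd W x ∧ ¬ TwoTorsionRamifiedAtTwo x))) →
      W.selmerCorank 2 = 0 → W.analyticRank = 0)
    (hR : ∀ (W : WeierstrassCurve ℚ) [W.IsElliptic] [W.IsGloballyMinimal], ¬ W.HasCM → Mult W 2 →
      (∃ x : ℚ, HasRationalTwoTorsionX W x ∧ TwoTorsionRamifiedAtTwo x ∧ TwoTorsionOdd W x) →
      W.selmerCorank 2 = 0 → W.analyticRank = 0)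
    (h2c : ∀ (W : WeierstrassCurve ℚ) [W.IsElliptic] [W.IsGloballyMinimal], ¬ W.HasCM → Mult W 2 →
      (∀ P : W.toAffine.Point, 2 • P = 0 → P = 0) → ¬ W.HasSurjectiveModNGaloisRep 2 →
      W.selmerCorank 2 = 0 → W.analyticRank = 0)
    (h4 : ∀ (W : WeierstrassCurve ℚ) [W.IsElliptic] [W.IsGloballyMinimal], ¬ W.HasCM → Mult W 2 →
      W.HasSurjectiveModNGaloisRep 2 → ¬ W.HasSurjectiveModNGaloisRep 4 →
      W.selmerCorank 2 = 0 → W.analyticRank = 0)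
    (h8 : ∀ (W : WeierstrassCurve ℚ) [W.IsElliptic] [W.IsGloballyMinimal], ¬ W.HasCM → Mult W 2 →
      W.HasSurjectiveModNGaloisRep 4 → ¬ W.HasSurjectiveModNGaloisRep 8 →
      W.selmerCorank 2 = 0 → W.analyticRank = 0) :
    ∀ (W : WeierstrassCurve ℚ) [W.IsElliptic] [W.IsGloballyMinimal], ¬ W.HasCM → Mult W 2 →
      ¬ (∀ m : ℕ, W.HasSurjectiveModNGaloisRep (2 ^ m : ℕ)) → W.selmerCorank 2 = 0 → W.analyticRank = 0 := by
  intro W _ _ hCM hm hoff hc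
  exact offHabitat_elim_strata hoff (fun h ↦ mult_twoTorsion_rankZero_of_mixed_of_ramifiedOdd hM hR W hCM hm h hc)
    (fun h h' ↦ h2c W hCM hm h h' hc) (fun h h' ↦ h4 W hCM hm h h' hc) (fun h h' ↦ h8 W hCM hm h h' hc)

/-- **Item 19219 `MultiplicativeRankZeroTwoConverse` BY NAME from Kolyvagin at `2` on the habitat (S3 items 24622 V1′ +
24623 V2♭ + 24405 + PRINT, conv-1 GEN 17 p607060) and the off-habitat LEVEL strata with (β) split into (M)/(R) along
`ℤ/2`-linked pairs at a multiplicative `2`.**  The route decl, fully qualified; every binder is a research statement or a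
printed fact displayed by name. [cite: WZhang2014, Thm. 1.1 (shape at p ≥ 5)]
[cite: GreenbergLNM1716, Props. 5.13–5.14 (chunks p0168–p0170)] [cite: DokchitserDokchitserMathZ2012, Theorem (1)–(3)] -/
theorem multiplicativeRankZeroTwoConverse_of_kolyvaginAtTwo_of_pairs_of_strata
    (hV1 : KolyvaginNonvanishingAtTwoFrame) (hV2 : KolyvaginCorankLowerBoundAtTwo)
    (hT : Summit.BirchSwinnertonDyer.BirchSwinnertonDyer.Theses.TwoAdicConverse.NoTwoTorsionOverK)
    (hmod : ModularForms.exists_isNewformOf)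
    (hBFH : bumpFriedbergHoffstein_exists_heegnerField_split_twist_simpleZero)
    (hpar : ∀ (V : WeierstrassCurve ℚ) [V.IsElliptic], p_parity V 2)
    (hGZK : rank_eq_analyticRank_of_analyticRank_le_one)
    (hE : WeierstrassCurve.hasEntireLFunction_rat)
    (hGZ : ∀ (V : WeierstrassCurve ℚ) (N : ℕ) [NeZero N] (K : Type) [Field K] [NumberField K],
      analyticRankEK_eq_one_iff_heegner_nonTorsion V N K)
    (hrec : ∀ (N : ℕ) [NeZero N] (V : WeierstrassCurve ℚ) (K : Type) [Field K] [NumberField K],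
      heegnerPointOfConductor_one_galoisConj N V K)
    (hM : ∀ (W : WeierstrassCurve ℚ) [W.IsElliptic] [W.IsGloballyMinimal], ¬ W.HasCM → Mult W 2 →
      (∃ x : ℚ, HasRationalTwoTorsionX W x ∧
        ((TwoTorsionRamifiedAtTwo x ∧ ¬ TwoTorsionOdd W x) ∨ (TwoTorsionOdd W x ∧ ¬ TwoTorsionRamifiedAtTwo x))) →
      W.selmerCorank 2 = 0 → W.analyticRank = 0)
    (hR : ∀ (W : WeierstrassCurve ℚ) [W.IsElliptic] [W.IsGloballyMinimal], ¬ W.HasCM → Mult W 2 →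
      (∃ x : ℚ, HasRationalTwoTorsionX W x ∧ TwoTorsionRamifiedAtTwo x ∧ TwoTorsionOdd W x) →
      W.selmerCorank 2 = 0 → W.analyticRank = 0)
    (h2c : ∀ (W : WeierstrassCurve ℚ) [W.IsElliptic] [W.IsGloballyMinimal], ¬ W.HasCM → Mult W 2 →
      (∀ P : W.toAffine.Point, 2 • P = 0 → P = 0) → ¬ W.HasSurjectiveModNGaloisRep 2 →
      W.selmerCorank 2 = 0 → W.analyticRank = 0)
    (h4 : ∀ (W : WeierstrassCurve ℚ) [W.IsElliptic] [W.IsGloballyMinimal], ¬ W.HasCM → Mult W 2 →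
      W.HasSurjectiveModNGaloisRep 2 → ¬ W.HasSurjectiveModNGaloisRep 4 →
      W.selmerCorank 2 = 0 → W.analyticRank = 0)
    (h8 : ∀ (W : WeierstrassCurve ℚ) [W.IsElliptic] [W.IsGloballyMinimal], ¬ W.HasCM → Mult W 2 →
      W.HasSurjectiveModNGaloisRep 4 → ¬ W.HasSurjectiveModNGaloisRep 8 →
      W.selmerCorank 2 = 0 → W.analyticRank = 0) :
    Summit.BirchSwinnertonDyer.BirchSwinnertonDyer.Theses.TwoAdicConverse.MultiplicativeRankZeroTwoConverse :=
  multiplicativeRankZeroTwoConverse_of_kolyvaginAtTwo_of_offBigImage hV1 hV2 hT hmod hBFH hpar hGZK hE hGZ hrec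
    (mult_offBigImage_rankZero_of_pairs_of_strata hM hR h2c h4 h8)

end Summit.BirchSwinnertonDyer.BirchSwinnertonDyer.Theorems.TwoAdicOffHabitat

end
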